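import Literature.NumberTheory.LFunctions.FordLemma36Recursion
import HarnessLib

/-!
# Ford's Lemma 3.6, the one-step inequalities (3.11)–(3.17) for `δ₀(k, r, Δ)` with `r = ⌊k − Δ/k + 1⌋`

Topic `Literature/NumberTheory/LFunctions`. Everything here is PROVED (no named facts). Third file of the
definition-free formalization of Lemma 3.6 of K. Ford, Proc. LMS 85 (2002) (`FordLemma36Recursion.lean`:
the closed form for `Δ_n` from (3.14); `FordLemma36Constants.lean`: the closed form for `C_n`). Here the
hypotheses of those two files are derived from the objects of Lemmas 3.4–3.5, again without fixing a
definition: the `φ`-recursion of Lemma 3.4 is an arbitrary function `φ` with `φ_j = 1/r`,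
`φ_J = 1/(2r) + ((2kr + J² − J − y)/(4kr)) φ_{J+1}` (`1 ≤ J < j`; `y = 2Δ − (k−r)(k−r+1)`, so that
`k²+k+r²−r+J²−J−2Δ = 2kr + J²−J−y`), with `(j−1)(j−2) ≤ y` ((3.8)), and `Δ' = Δ − k + (φ₁/2)(2kr − y)`
is Lemma 3.4's `Δ(1−φ₁) − k + (φ₁/2)(k²+k+r²−r)`.

* Section `Phi` (any `k, r > 0`, `0 ≤ y ≤ 2kr`): `FordL36.theta_bounds` — (3.12) iterated,
  `0 ≤ φ_J − φ* ≤ 2^{−(j−J)}(1/r − φ*) + (φ*/(4kr))∑_{i=J}^{j−1} 2^{−(i−J)}(i²−i)` (`φ* = 2k/(2kr+y)`);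
  `FordL36.theta_one_le` — `θ₁ = φ₁ − φ* ≤ 2^{1−j}(1/r − φ*) + 2φ*/(kr)` (`∑ 2^{1−i}(i²−i) = 8 − …`);
  `FordL36.phiStar_le_phi` (`φ_J ≥ φ*`, the content of "(3.11) and (3.12) imply `φ_i ≥ 1/(k+1)`"),
  `FordL36.phi_le_inv` (`φ_J ≤ 1/r`).
* Section `Step` (`k ≥ 1000`, `k < Δ ≤ (k²−k)/2`, `k − Δ/k < r ≤ k − Δ/k + 1`): `basic_ranges`;
  `phiStar_ge_inv_succ` — **(3.11)** `φ* ≥ 1/(k+1)`; `phiStar_le` — **(3.15)**; `G_bounds` — **(3.17)**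
  (lower bound directly from `kδ ≥ 1`; upper bound: `{t : t ≤ U·D(t)}` with `D` concave contains `r` as
  soon as it contains the two endpoints, via `U·D(r) − r = λ q(a) + (1−λ) q(a+1) + Uλ(1−λ)`);
  `step_bounds` — for `0 ≤ θ₁ ≤ 16/(7k²r)`, `φ₁ = φ* + θ₁ ≤ 1/r`: **(3.14)** `Δ'/k² ≤ F_k(Δ/k²)`
  (through (3.16); note `r − 1 + (k²+k−2Δ)/r ≤ 2k(1−δ)` holds exactly since `(r−u)(r−u−1) ≤ 0`,
  `u = k − kδ`), the lower step `Δ' ≥ Δ(1 − 2/k)` and `Δ' ≤ Δ`; `y_ge` (`y ≥ 2k − 2`),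
  `half_pow_le` (`j² ≥ 2k−2 ⇒ 2^{1−j} ≤ 0.32/k⁴`), `theta_one_le_final` (`θ₁ ≤ 16/(7k²r)`).

So for Ford's sequence (`r_n = ⌊k − Δ_n/k + 1⌋`, `j` maximal in (3.8)) the hypotheses `hrec`, `hlow`,
`hanti` of `FordL36.delta_le_closed_form` / `FordL36.C_le_closed_form` hold while `Δ_n > k`.

## References

* K. Ford, *Vinogradov's integral and bounds for the Riemann zeta function*, Proc. London Math.
  Soc. (3) 85 (2002), 565–633; arXiv:1910.08209: Lemma 3.4 ((3.8), the `φ_J`), proof of Lemma 3.5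
  ((3.11)–(3.12)), proof of Lemma 3.6 ((3.13)–(3.17)). [Ford2002]
-/

noncomputable section

open Real Set Finset

namespace Literature.NumberTheory.LFunctions

namespace FordL36

/-! ### The `φ`-recursion of Lemma 3.4 and the deviations `θ_J = φ_J − φ*` ((3.12)) -/

section Phi

variable {k r y : ℝ} {j : ℕ} {φ : ℕ → ℝ}
  (hk : 0 < k) (hr : 0 < r) (hy0 : 0 ≤ y) (hy1 : y ≤ 2 * k * r)
  (hφj : φ j = 1 / r)
  (hφ : ∀ J : ℕ, 1 ≤ J → J < j → φ J = 1 / (2 * r) + (2 * k * r + (J : ℝ) ^ 2 - J - y) / (4 * k * r) * φ (J + 1))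
  (hj : ((j : ℝ) - 1) * ((j : ℝ) - 2) ≤ y)

/-- Ford's `φ* = 2k/(2rk + y)`. [cite: Ford2002, (3.11)] -/
def phiStar (k r y : ℝ) : ℝ := 2 * k / (2 * k * r + y)

include hk hr hy0 in
/-- Auxiliary step (elementary consequence of the definitions and the standing hypotheses). [folklore] -/
theorem phiStar_pos : 0 < phiStar k r y := by unfold phiStar; positivity

include hk hr hy0 in
/-- `φ* ≤ 1/r` (`y ≥ 0`). [cite: Ford2002, proof of Lemma 3.5 ("θ_j = 1/r − φ* ≥ 0")] -/
theorem phiStar_le_inv : phiStar k r y ≤ 1 / r := by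
  unfold phiStar
  rw [div_le_div_iff₀ (by positivity) hr]
  nlinarith

include hj in
/-- For `1 ≤ J ≤ j − 1`: `J² − J ≤ (j−1)(j−2) ≤ y`. [cite: Ford2002, proof of Lemma 3.5] -/
theorem sq_sub_le_y {J : ℕ} (hJ1 : 1 ≤ J) (hJ : J < j) : (J : ℝ) ^ 2 - J ≤ y := by
  have hJle : (J : ℝ) ≤ (j : ℝ) - 1 := by
    have : J + 1 ≤ j := hJ
    have : ((J + 1 : ℕ) : ℝ) ≤ j := by exact_mod_cast this
    push_cast at this; linarith
  have hJ1' : (1 : ℝ) ≤ J := by exact_mod_cast hJ1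
  nlinarith

include hk hr hy0 hy1 hφj hφ hj in
/-- **(3.12) and its iteration**: for `1 ≤ J ≤ j`,
`0 ≤ φ_J − φ* ≤ 2^{−(j−J)}(1/r − φ*) + (φ*/(4kr)) ∑_{i=J}^{j−1} 2^{−(i−J)} (i² − i)`.
[cite: Ford2002, proof of Lemma 3.5, (3.12), and proof of Lemma 3.6 ("Iterating (3.12) gives …")] -/
theorem theta_bounds : ∀ m : ℕ, m < j →
    0 ≤ φ (j - m) - phiStar k r y ∧
      φ (j - m) - phiStar k r y ≤ (1 / 2) ^ m * (1 / r - phiStar k r y) +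
        phiStar k r y / (4 * k * r) * ∑ i ∈ Finset.Ico (j - m) j, (1 / 2 : ℝ) ^ (i - (j - m)) * ((i : ℝ) ^ 2 - i) := by
  intro m
  induction m with
  | zero =>
    intro _
    simp only [Nat.sub_zero, pow_zero, one_mul, Finset.Ico_self, Finset.sum_empty, mul_zero, add_zero]
    rw [hφj]
    exact ⟨by linarith [phiStar_le_inv hk hr hy0], le_rfl⟩
  | succ m ih =>
    intro hm
    have hm' : m < j := by omega
    obtain ⟨ih0, ih1⟩ := ih hm'
    set J : ℕ := j - (m + 1) with hJ
    have hJ1 : 1 ≤ J := by omega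
    have hJj : J < j := by omega
    have hJsucc : J + 1 = j - m := by omega
    have hrec := hφ J hJ1 hJj
    rw [hJsucc] at hrec
    set ρ : ℝ := (2 * k * r + (J : ℝ) ^ 2 - J - y) / (4 * k * r) with hρ
    have hJy := sq_sub_le_y hj hJ1 hJj
    have hJJ : 0 ≤ (J : ℝ) ^ 2 - J := by
      have : (1 : ℝ) ≤ J := by exact_mod_cast hJ1
      nlinarith
    have hρ0 : 0 ≤ ρ := by rw [hρ]; exact div_nonneg (by linarith) (by positivity)
    have hρ1 : ρ ≤ 1 / 2 := by
      rw [hρ, div_le_div_iff₀ (by positivity) (by norm_num)]; nlinarith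
    -- `θ_J = ρ θ_{J+1} + ((J²−J)/(4kr)) φ*`
    have hθ : φ J - phiStar k r y = ρ * (φ (j - m) - phiStar k r y) + ((J : ℝ) ^ 2 - J) / (4 * k * r) * phiStar k r y := by
      rw [hrec, hρ, phiStar]
      field_simp
      ring
    have hps := (phiStar_pos hk hr hy0).le
    constructor
    · rw [hθ]; positivity
    · rw [hθ]
      -- the sum over `Ico J j` splits off the term `i = J`
      have hsum : ∑ i ∈ Finset.Ico J j, (1 / 2 : ℝ) ^ (i - J) * ((i : ℝ) ^ 2 - i)
          = ((J : ℝ) ^ 2 - J) + (1 / 2) * ∑ i ∈ Finset.Ico (j - m) j, (1 / 2 : ℝ) ^ (i - (j - m)) * ((i : ℝ) ^ 2 - i) := by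
        rw [Finset.sum_eq_sum_Ico_succ_bot hJj, Nat.sub_self, pow_zero, one_mul, hJsucc, Finset.mul_sum]
        congr 1
        refine Finset.sum_congr rfl fun i hi ↦ ?_
        rw [Finset.mem_Ico] at hi
        have e : i - J = (i - (j - m)) + 1 := by omega
        rw [e, pow_succ]; ring
      rw [hsum]
      have e2 : (1 / 2 : ℝ) ^ (m + 1) = (1 / 2) * (1 / 2) ^ m := by rw [pow_succ]; ring
      rw [e2]
      have hb := mul_le_mul_of_nonneg_left ih1 hρ0
      have hc : ρ * ((1 / 2) ^ m * (1 / r - phiStar k r y) +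
          phiStar k r y / (4 * k * r) * ∑ i ∈ Finset.Ico (j - m) j, (1 / 2 : ℝ) ^ (i - (j - m)) * ((i : ℝ) ^ 2 - i))
          ≤ (1 / 2) * ((1 / 2) ^ m * (1 / r - phiStar k r y) +
          phiStar k r y / (4 * k * r) * ∑ i ∈ Finset.Ico (j - m) j, (1 / 2 : ℝ) ^ (i - (j - m)) * ((i : ℝ) ^ 2 - i)) := by
        refine mul_le_mul_of_nonneg_right hρ1 ?_
        have h0 : 0 ≤ 1 / r - phiStar k r y := by linarith [phiStar_le_inv hk hr hy0]
        have h1 : 0 ≤ ∑ i ∈ Finset.Ico (j - m) j, (1 / 2 : ℝ) ^ (i - (j - m)) * ((i : ℝ) ^ 2 - i) := by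
          refine Finset.sum_nonneg fun i hi ↦ mul_nonneg (by positivity) ?_
          rw [Finset.mem_Ico] at hi
          have : (1 : ℝ) ≤ i := by exact_mod_cast (show 1 ≤ i by omega)
          nlinarith
        positivity
      have e3 : ((J : ℝ) ^ 2 - J) / (4 * k * r) * phiStar k r y = phiStar k r y / (4 * k * r) * ((J : ℝ) ^ 2 - J) := by ring
      rw [e3]
      nlinarith [hb, hc]

/-- `∑_{i=1}^{n} 2^{1−i}(i² − i) = 8 − (n² + 3n + 4)2^{1−n} ≤ 8`. [folklore] -/
theorem sum_sq_geom (n : ℕ) : ∑ i ∈ Finset.Ico 1 (n + 1), (1 / 2 : ℝ) ^ (i - 1) * ((i : ℝ) ^ 2 - i)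
    = 8 - ((n : ℝ) ^ 2 + 3 * n + 4) * (1 / 2) ^ n * 2 := by
  induction n with
  | zero => simp; norm_num
  | succ n ih =>
    rw [Finset.sum_Ico_succ_top (by omega), ih, Nat.add_sub_cancel, pow_succ]
    push_cast
    ring

include hk hr hy0 hy1 hφj hφ hj in
/-- **`θ₁ ≤ 2^{1−j}(1/r − φ*) + 2φ*/(kr)`** (Ford: "θ₁ ≤ 2^{1−j}θ_j + ∑ 2^{1−h}(h²−h)φ*/(4kr) ≤ 2^{1−j}/r + 2φ*/(kr)").
[cite: Ford2002, proof of Lemma 3.6 ("Iterating (3.12) gives …")] -/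
theorem theta_one_le (hj1 : 1 ≤ j) :
    0 ≤ φ 1 - phiStar k r y ∧
      φ 1 - phiStar k r y ≤ (1 / 2) ^ (j - 1) * (1 / r - phiStar k r y) + 2 * phiStar k r y / (k * r) := by
  have h := theta_bounds hk hr hy0 hy1 hφj hφ hj (j - 1) (by omega)
  rw [show j - (j - 1) = 1 by omega] at h
  refine ⟨h.1, h.2.trans ?_⟩
  have hS : ∑ i ∈ Finset.Ico 1 j, (1 / 2 : ℝ) ^ (i - 1) * ((i : ℝ) ^ 2 - i) ≤ 8 := by
    obtain ⟨n, rfl⟩ : ∃ n, j = n + 1 := ⟨j - 1, by omega⟩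
    rw [sum_sq_geom n]
    have : 0 ≤ ((n : ℝ) ^ 2 + 3 * n + 4) * (1 / 2) ^ n * 2 := by positivity
    linarith
  have hps := (phiStar_pos hk hr hy0).le
  have : phiStar k r y / (4 * k * r) * ∑ i ∈ Finset.Ico 1 j, (1 / 2 : ℝ) ^ (i - 1) * ((i : ℝ) ^ 2 - i)
      ≤ phiStar k r y / (4 * k * r) * 8 := mul_le_mul_of_nonneg_left hS (by positivity)
  have e : phiStar k r y / (4 * k * r) * 8 = 2 * phiStar k r y / (k * r) := by field_simp; ring
  linarith

include hk hr hy0 hy1 hφj hφ hj in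
/-- **`φ_J ≥ φ*` for `1 ≤ J ≤ j`** (hence `φ_J ≥ 1/(k+1)` once (3.11) holds). [cite: Ford2002, proof of Lemma 3.5 ("Thus (3.11) and (3.12) imply that φ_i ≥ φ* ≥ 1/(k+1)")] -/
theorem phiStar_le_phi {J : ℕ} (hJ1 : 1 ≤ J) (hJ : J ≤ j) : phiStar k r y ≤ φ J := by
  have h := theta_bounds hk hr hy0 hy1 hφj hφ hj (j - J) (by omega)
  rw [show j - (j - J) = J by omega] at h
  linarith [h.1]

include hk hr hy0 hy1 hφj hφ hj in
/-- `φ_J ≤ 1/r` for `1 ≤ J ≤ j`. [cite: Ford2002, proof of Lemma 3.4 ("By (3.8), φ_i ≤ 1/r for each i")] -/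
theorem phi_le_inv : ∀ m : ℕ, m < j → φ (j - m) ≤ 1 / r := by
  intro m
  induction m with
  | zero => intro _; rw [Nat.sub_zero, hφj]
  | succ m ih =>
    intro hm
    have ihm := ih (by omega)
    set J : ℕ := j - (m + 1) with hJ
    have hJ1 : 1 ≤ J := by omega
    have hJj : J < j := by omega
    have hJsucc : J + 1 = j - m := by omega
    have hrec := hφ J hJ1 hJj
    rw [hJsucc] at hrec
    have hJy := sq_sub_le_y hj hJ1 hJj
    have hJJ : 0 ≤ (J : ℝ) ^ 2 - J := by
      have : (1 : ℝ) ≤ J := by exact_mod_cast hJ1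
      nlinarith
    have hρ0 : 0 ≤ (2 * k * r + (J : ℝ) ^ 2 - J - y) / (4 * k * r) := div_nonneg (by linarith) (by positivity)
    have hρ1 : (2 * k * r + (J : ℝ) ^ 2 - J - y) / (4 * k * r) ≤ 1 / 2 := by
      rw [div_le_div_iff₀ (by positivity) (by norm_num)]; nlinarith
    have hps := phiStar_le_phi hk hr hy0 hy1 hφj hφ hj (J := j - m) (by omega) (by omega)
    have hps0 := (phiStar_pos hk hr hy0).le
    rw [hrec]
    have : (2 * k * r + (J : ℝ) ^ 2 - J - y) / (4 * k * r) * φ (j - m) ≤ 1 / 2 * (1 / r) :=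
      mul_le_mul hρ1 ihm (by linarith) (by norm_num)
    have e : 1 / (2 * r) + 1 / 2 * (1 / r) = 1 / r := by field_simp; ring
    linarith

end Phi

/-! ### The one-step bounds (3.13)–(3.17) for `r = ⌊k − Δ/k + 1⌋` -/

section Step

variable {k Δ r θ₁ : ℝ} (hk : 1000 ≤ k) (hΔk : k < Δ) (hΔ : Δ ≤ (k ^ 2 - k) / 2)
  (hr1 : k - Δ / k < r) (hr2 : r ≤ k - Δ / k + 1)

/-- `y = 2Δ − (k−r)(k−r+1)`. [cite: Ford2002, proof of Lemma 3.5] -/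
def yv (k r Δ : ℝ) : ℝ := 2 * Δ - (k - r) * (k - r + 1)

include hk hΔk hΔ hr1 hr2 in
/-- Basic ranges: with `δ = Δ/k²`, `1/k < δ ≤ (1 − 1/k)/2`, `k/2 ≤ r ≤ k`, `kδ(2k−kδ−1) ≤ y ≤ kδ(2k−kδ+1)`,
`0 ≤ y ≤ 2kr`. [cite: Ford2002, proof of Lemma 3.6 ("By the definition of r_n, kδ(2k−kδ−1) ≤ y ≤ kδ(2k−kδ+1)")] -/
theorem basic_ranges :
    1 / k < Δ / k ^ 2 ∧ Δ / k ^ 2 ≤ (1 - 1 / k) / 2 ∧ k / 2 ≤ r ∧ r ≤ k ∧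
    Δ / k * (2 * k - Δ / k - 1) ≤ yv k r Δ ∧ yv k r Δ ≤ Δ / k * (2 * k - Δ / k + 1) ∧
    0 ≤ yv k r Δ ∧ yv k r Δ ≤ 2 * k * r := by
  have hk0 : 0 < k := by linarith
  have hδ1 : 1 / k < Δ / k ^ 2 := by
    rw [div_lt_div_iff₀ hk0 (by positivity)]; nlinarith
  have hδ2 : Δ / k ^ 2 ≤ (1 - 1 / k) / 2 := by
    rw [div_le_iff₀ (by positivity)]
    have e : (1 - 1 / k) / 2 * k ^ 2 = (k ^ 2 - k) / 2 := by field_simp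
    rw [e]; exact hΔ
  have hu1 : 1 < Δ / k := by rw [lt_div_iff₀ hk0]; linarith
  have hu2 : Δ / k ≤ (k - 1) / 2 := by
    rw [div_le_iff₀ hk0]; nlinarith
  have hr3 : k / 2 ≤ r := by linarith
  have hr4 : r ≤ k := by linarith
  -- `u = k − r ∈ [Δ/k − 1, Δ/k)`
  have hy : yv k r Δ = 2 * Δ - (k - r) * (k - r + 1) := rfl
  have huA : k - r < Δ / k := by linarith
  have huB : Δ / k - 1 ≤ k - r := by linarith
  have hu0 : 0 ≤ k - r := by linarith
  have hyA : Δ / k * (2 * k - Δ / k - 1) ≤ yv k r Δ := by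
    rw [hy]
    have e : Δ / k * (2 * k - Δ / k - 1) = 2 * Δ - Δ / k * (Δ / k + 1) := by field_simp; ring
    rw [e]; nlinarith
  have hyB : yv k r Δ ≤ Δ / k * (2 * k - Δ / k + 1) := by
    rw [hy]
    have e : Δ / k * (2 * k - Δ / k + 1) = 2 * Δ - (Δ / k - 1) * (Δ / k) := by field_simp; ring
    rw [e]; nlinarith
  have hΔ0 : 0 < Δ := by linarith
  refine ⟨hδ1, hδ2, hr3, hr4, hyA, hyB, ?_, ?_⟩
  · refine le_trans ?_ hyA
    exact mul_nonneg (div_nonneg hΔ0.le hk0.le) (by nlinarith)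
  · rw [hy]; nlinarith

include hk hΔk hΔ hr1 hr2 in
/-- **(3.11) holds**: `φ* = 2k/(2kr + y) ≥ 2/((2−δ²)k + 2 + δ) ≥ 1/(k+1)`.
[cite: Ford2002, proof of Lemma 3.6 ("Hence φ* ≥ … ≥ 1/(k+1), so (3.11) holds")] -/
theorem phiStar_ge_inv_succ : 1 / (k + 1) ≤ phiStar k r (yv k r Δ) := by
  have hk0 : 0 < k := by linarith
  obtain ⟨hδ1, hδ2, hr3, hr4, hyA, hyB, hy0, hy2⟩ := basic_ranges hk hΔk hΔ hr1 hr2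
  unfold phiStar
  have hD : 0 < 2 * k * r + yv k r Δ := by nlinarith
  rw [div_le_div_iff₀ (by positivity) hD]
  -- `2kr + y ≤ 2k(k+1)`: `2kr ≤ 2k(k − Δ/k + 1)`, `y ≤ (Δ/k)(2k − Δ/k + 1)`
  have h1 : 2 * k * r ≤ 2 * k * (k - Δ / k + 1) := by nlinarith
  have hu1 : 1 < Δ / k := by rw [lt_div_iff₀ hk0]; linarith
  nlinarith

include hk hΔk hΔ hr1 hr2 in
/-- **(3.15)**: `φ* ≤ 2/((2−δ²)k − δ) ≤ 8/(7k) − 0.16/k³`. [cite: Ford2002, (3.15)] -/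
theorem phiStar_le : phiStar k r (yv k r Δ) ≤ 8 / (7 * k) - 0.16 / k ^ 3 := by
  have hk0 : 0 < k := by linarith
  obtain ⟨hδ1, hδ2, hr3, hr4, hyA, hyB, hy0, hy2⟩ := basic_ranges hk hΔk hΔ hr1 hr2
  set δ := Δ / k ^ 2 with hδ
  have hΔδ : Δ = δ * k ^ 2 := by rw [hδ]; field_simp
  have huδ : Δ / k = δ * k := by rw [hΔδ]; field_simp
  -- `2kr + y ≥ (2 − δ²)k² − kδ`
  have hden : (2 - δ ^ 2) * k ^ 2 - k * δ ≤ 2 * k * r + yv k r Δ := by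
    rw [huδ] at hyA
    have : 2 * k * (k - δ * k) ≤ 2 * k * r := by rw [huδ] at hr1; nlinarith
    nlinarith
  have hdenpos : 0 < (2 - δ ^ 2) * k ^ 2 - k * δ := by nlinarith
  have h1 : phiStar k r (yv k r Δ) ≤ 2 * k / ((2 - δ ^ 2) * k ^ 2 - k * δ) := by
    unfold phiStar
    exact div_le_div_of_nonneg_left (by linarith) hdenpos hden
  refine h1.trans ?_
  -- `(2−δ²)k − δ ≥ (7k + 1/k)/4` (decreasing in `δ`, equality at `δ = (1−1/k)/2`), then `≤ 8/(7k) − 0.16/k³`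
  have hδ0 : 0 < δ := lt_trans (by positivity) hδ1
  set δm : ℝ := (1 - 1 / k) / 2 with hδm
  have hem : (2 - δm ^ 2) * k - δm = (7 * k + 1 / k) / 4 := by rw [hδm]; field_simp; ring
  have hdiff : ((2 - δ ^ 2) * k - δ) - ((2 - δm ^ 2) * k - δm) = (δm - δ) * (k * (δm + δ) + 1) := by ring
  have hk1 : 1 / k ≤ 1 := by rw [div_le_one hk0]; linarith
  have hδm0 : 0 ≤ δm := by rw [hδm]; linarith
  have h2 : (7 * k + 1 / k) / 4 ≤ (2 - δ ^ 2) * k - δ := by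
    have : 0 ≤ (δm - δ) * (k * (δm + δ) + 1) := mul_nonneg (by linarith) (by positivity)
    linarith
  have h3 : 2 * k / ((2 - δ ^ 2) * k ^ 2 - k * δ) ≤ 8 * k / (7 * k ^ 2 + 1) := by
    have e1 : (2 - δ ^ 2) * k ^ 2 - k * δ = k * ((2 - δ ^ 2) * k - δ) := by ring
    have e2 : 8 * k / (7 * k ^ 2 + 1) = 2 * k / (k * ((7 * k + 1 / k) / 4)) := by
      field_simp; ring
    rw [e1, e2]
    exact div_le_div_of_nonneg_left (by linarith) (by positivity) (mul_le_mul_of_nonneg_left h2 hk0.le)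
  refine h3.trans ?_
  rw [div_le_iff₀ (by positivity)]
  have e3 : (8 / (7 * k) - 0.16 / k ^ 3) * (7 * k ^ 2 + 1) = 8 * k + (0.16 * k ^ 2 - 1.12) / (7 * k ^ 3) * 7 / 7 * 7 / 7 := by
    field_simp; ring
  have h4 : 0 ≤ (0.16 * k ^ 2 - 1.12) / (7 * k ^ 3) := div_nonneg (by nlinarith) (by positivity)
  nlinarith [e3, h4]

set_option maxHeartbeats 1000000 in
include hk hΔk hΔ hr1 hr2 in
/-- **(3.17)**: `(1−δ)/(2k) ≤ r/(2rk + y) ≤ (1−δ)/((2−δ²)k) + δ/((2−δ²)²k²)` (`δ = Δ/k²`). The lower bound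
is `y ≤ 2krδ/(1−δ)` (i.e. `kδ ≥ 1`); for the upper bound, `{t : t ≤ U·D(t)}` (`D(t) = 2kt + 2Δ − (k−t)(k−t+1)`
concave) contains `r` as soon as it contains the endpoints `k − kδ`, `k − kδ + 1` of the interval of `r`.
[cite: Ford2002, (3.17) and its proof] -/
theorem G_bounds :
    (1 - Δ / k ^ 2) / (2 * k) ≤ r / (2 * k * r + yv k r Δ) ∧
      r / (2 * k * r + yv k r Δ) ≤ (1 - Δ / k ^ 2) / ((2 - (Δ / k ^ 2) ^ 2) * k) +
        (Δ / k ^ 2) / ((2 - (Δ / k ^ 2) ^ 2) ^ 2 * k ^ 2) := by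
  have hk0 : 0 < k := by linarith
  obtain ⟨hδ1, hδ2, hr3, hr4, hyA, hyB, hy0, hy2⟩ := basic_ranges hk hΔk hΔ hr1 hr2
  set δ := Δ / k ^ 2 with hδ
  have hΔδ : Δ = δ * k ^ 2 := by rw [hδ]; field_simp
  have huδ : Δ / k = δ * k := by rw [hΔδ]; field_simp
  have hδ0 : 0 < δ := lt_trans (by positivity) hδ1
  have hkδ : 1 < k * δ := by rw [div_lt_iff₀ hk0] at hδ1; linarith
  have hδhalf : δ < 1 / 2 := by
    have : 0 < 1 / k := by positivity
    linarith
  have hd2 : 0 < 2 - δ ^ 2 := by nlinarith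
  have hD : 0 < 2 * k * r + yv k r Δ := by nlinarith
  have hy : yv k r Δ = 2 * Δ - (k - r) * (k - r + 1) := rfl
  have h1δ : 0 ≤ 1 - δ := by linarith
  constructor
  · -- lower bound
    rw [div_le_div_iff₀ (by positivity) hD]
    rw [huδ] at hyB hr1
    -- `(1−δ) y ≤ 2krδ`: `(1−δ) y ≤ (1−δ) kδ (2k − kδ + 1) ≤ 2k·k(1−δ)·δ ≤ 2krδ`
    have h1 : (1 - δ) * yv k r Δ ≤ (1 - δ) * (δ * k * (2 * k - δ * k + 1)) :=
      mul_le_mul_of_nonneg_left hyB h1δ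
    have h2 : (1 - δ) * (δ * k * (2 * k - δ * k + 1)) ≤ (1 - δ) * (δ * k * (2 * k)) := by
      refine mul_le_mul_of_nonneg_left ?_ h1δ
      have h0 : 0 ≤ δ * k := by positivity
      have hp : 0 ≤ δ * k * (δ * k - 1) := mul_nonneg h0 (by nlinarith)
      have e : δ * k * (2 * k - δ * k + 1) = δ * k * (2 * k) - δ * k * (δ * k - 1) := by ring
      rw [e]; linarith
    have h3 : (1 - δ) * (δ * k * (2 * k)) ≤ r * (δ * (2 * k)) := by
      have hkr : k * (1 - δ) ≤ r := by linarith
      have h0 : 0 ≤ δ * (2 * k) := by positivity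
      have := mul_le_mul_of_nonneg_right hkr h0
      have e : (1 - δ) * (δ * k * (2 * k)) = k * (1 - δ) * (δ * (2 * k)) := by ring
      rw [e]; exact this
    have e : (1 - δ) * (2 * k * r + yv k r Δ) = r * (2 * k) - r * (δ * (2 * k)) + (1 - δ) * yv k r Δ := by ring
    rw [e]
    linarith
  · -- upper bound by concavity
    set U : ℝ := (1 - δ) / ((2 - δ ^ 2) * k) + δ / ((2 - δ ^ 2) ^ 2 * k ^ 2) with hU
    have hU0 : 0 ≤ U := by rw [hU]; positivity
    set a : ℝ := k - k * δ with ha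
    set lam : ℝ := a + 1 - r with hlam
    have hr1' := hr1
    have hr2' := hr2
    rw [huδ] at hr1' hr2'
    have hlam0 : 0 ≤ lam := by rw [hlam, ha]; linarith
    have hlam1 : lam ≤ 1 := by rw [hlam, ha]; linarith
    -- `D(t) = 2kt + 2Δ − (k−t)(k−t+1)`; values at the endpoints
    have hDa : 2 * k * a + (2 * Δ - (k - a) * (k - a + 1)) = k * ((2 - δ ^ 2) * k - δ) := by
      rw [ha, hΔδ]; ring
    have hDb : 2 * k * (a + 1) + (2 * Δ - (k - (a + 1)) * (k - (a + 1) + 1)) = k * ((2 - δ ^ 2) * k + 2 + δ) := by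
      rw [ha, hΔδ]; ring
    -- decomposition of `U·D(r) − r`
    have hdecomp : U * (2 * k * r + yv k r Δ) - r =
        lam * (U * (k * ((2 - δ ^ 2) * k - δ)) - a) + (1 - lam) * (U * (k * ((2 - δ ^ 2) * k + 2 + δ)) - (a + 1))
          + U * (lam * (1 - lam)) := by
      rw [← hDa, ← hDb, hy]
      have hr : r = lam * a + (1 - lam) * (a + 1) := by rw [hlam]; ring
      rw [hr]; ring
    -- endpoint checks
    have hqa : 0 ≤ U * (k * ((2 - δ ^ 2) * k - δ)) - a := by
      rw [hU, ha]
      have e : ((1 - δ) / ((2 - δ ^ 2) * k) + δ / ((2 - δ ^ 2) ^ 2 * k ^ 2)) * (k * ((2 - δ ^ 2) * k - δ)) - (k - k * δ)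
          = δ * (δ * ((2 - δ ^ 2) * k - 1)) / ((2 - δ ^ 2) ^ 2 * k) := by
        field_simp; ring
      rw [e]
      have hpos : 0 ≤ (2 - δ ^ 2) * k - 1 := by nlinarith
      positivity
    have hqb : 0 ≤ U * (k * ((2 - δ ^ 2) * k + 2 + δ)) - (a + 1) := by
      rw [hU, ha]
      have e : ((1 - δ) / ((2 - δ ^ 2) * k) + δ / ((2 - δ ^ 2) ^ 2 * k ^ 2)) * (k * ((2 - δ ^ 2) * k + 2 + δ)) - (k - k * δ + 1)
          = δ * (2 + δ) / ((2 - δ ^ 2) ^ 2 * k) := by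
        field_simp; ring
      rw [e]; positivity
    have hmain : 0 ≤ U * (2 * k * r + yv k r Δ) - r := by
      rw [hdecomp]
      have h3 : 0 ≤ U * (lam * (1 - lam)) := mul_nonneg hU0 (mul_nonneg hlam0 (by linarith))
      have h1 := mul_nonneg hlam0 hqa
      have h2 := mul_nonneg (by linarith : 0 ≤ 1 - lam) hqb
      linarith
    rw [div_le_iff₀ hD]; linarith

set_option maxHeartbeats 1000000 in
include hk hΔk hΔ hr1 hr2 in
/-- **The one-step bounds of Lemma 3.6 for Ford's `δ₀`**: with `y = 2Δ − (k−r)(k−r+1)`, `φ* = 2k/(2kr+y)` and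
`φ₁ = φ* + θ₁`, `0 ≤ θ₁ ≤ 16/(7k²r)`, `φ₁ ≤ 1/r` (as supplied by `theta_one_le`, `phi_le_inv`), the new exponent
`Δ' = Δ − k + (φ₁/2)(2kr − y)` (Lemma 3.4's `Δ' = Δ(1−φ₁) − k + (φ₁/2)(k²+k+r²−r)`) satisfies
**(3.14)** `Δ'/k² ≤ F_k(Δ/k²)`, the lower bound **`Δ' ≥ Δ(1 − 2/k)`** ("δ_m ≥ δ_{m−1}(1 − 2/k)") and
**`Δ' ≤ Δ`**, for `k ≥ 1000`, `k < Δ ≤ (k²−k)/2`, `k − Δ/k < r ≤ k − Δ/k + 1`.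
[cite: Ford2002, proof of Lemma 3.6, (3.14)–(3.17)] -/
theorem step_bounds (hθ0 : 0 ≤ θ₁) (hθ1 : θ₁ ≤ 16 / (7 * k ^ 2 * r))
    (hφ1 : phiStar k r (yv k r Δ) + θ₁ ≤ 1 / r) :
    (Δ - k + (phiStar k r (yv k r Δ) + θ₁) / 2 * (2 * k * r - yv k r Δ)) / k ^ 2 ≤ F k (Δ / k ^ 2) ∧
    Δ * (1 - 2 / k) ≤ Δ - k + (phiStar k r (yv k r Δ) + θ₁) / 2 * (2 * k * r - yv k r Δ) ∧
    Δ - k + (phiStar k r (yv k r Δ) + θ₁) / 2 * (2 * k * r - yv k r Δ) ≤ Δ := by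
  have hk0 : 0 < k := by linarith
  obtain ⟨hδ1, hδ2, hr3, hr4, hyA, hyB, hy0, hy2⟩ := basic_ranges hk hΔk hΔ hr1 hr2
  obtain ⟨hGlo, hGhi⟩ := G_bounds hk hΔk hΔ hr1 hr2
  set δ := Δ / k ^ 2 with hδ
  have hΔδ : Δ = δ * k ^ 2 := by rw [hδ]; field_simp
  have huδ : Δ / k = δ * k := by rw [hΔδ]; field_simp
  have hδ0 : 0 < δ := lt_trans (by positivity) hδ1
  have hkδ : 1 < k * δ := by rw [div_lt_iff₀ hk0] at hδ1; linarith
  have hk1 : 0 < 1 / k := by positivity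
  have hδhalf : δ < 1 / 2 := by linarith
  have hd2 : 0 < 2 - δ ^ 2 := by nlinarith
  have hr0 : 0 < r := by linarith
  have hD : 0 < 2 * k * r + yv k r Δ := by nlinarith
  set y := yv k r Δ with hydef
  have hy : y = 2 * Δ - (k - r) * (k - r + 1) := rfl
  set G : ℝ := r / (2 * k * r + y) with hG
  set ps : ℝ := phiStar k r y with hps
  -- (i) the main-term identity `(φ*/2)(2kr − y) = −k + 4k² G`
  have hi : ps / 2 * (2 * k * r - y) = -k + 4 * k ^ 2 * G := by
    rw [hps, hG, phiStar]; field_simp; ring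
  -- the quantity `Δ'`
  have hΔ' : Δ - k + (ps + θ₁) / 2 * (2 * k * r - y) = Δ - 2 * k + 4 * k ^ 2 * G + θ₁ / 2 * (2 * k * r - y) := by
    linear_combination hi
  have h2kry : 0 ≤ 2 * k * r - y := by linarith
  refine ⟨?_, ?_, ?_⟩
  · -- (3.14)
    -- (ii) `(θ₁/2)(2kr − y) ≤ 16(1−δ)/(7k)`, via `(2kr − y)/r = r − 1 + (k²+k−2Δ)/r ≤ 2k(1−δ)`
    have hratio : (2 * k * r - y) / r ≤ 2 * k * (1 - δ) := by
      rw [div_le_iff₀ hr0, hy]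
      -- `k² + k − 2Δ ≤ u(u+1)`, `u = k − kδ`, and `r − 1 + u(u+1)/r ≤ 2u` since `(r−u)(r−u−1) ≤ 0`
      set u : ℝ := k - k * δ with hu
      have hu1 : k ^ 2 + k - 2 * Δ ≤ u * (u + 1) := by
        have e : u * (u + 1) - (k ^ 2 + k - 2 * Δ) = k * δ * (k * δ - 1) := by rw [hu, hΔδ]; ring
        have : 0 ≤ k * δ * (k * δ - 1) := mul_nonneg (by positivity) (by linarith)
        linarith
      have hru0 : 0 < r - u := by rw [hu]; rw [huδ] at hr1; linarith
      have hru1 : r - u ≤ 1 := by rw [hu]; rw [huδ] at hr2; linarith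
      have hquad : (r - u) * (r - u - 1) ≤ 0 := mul_nonpos_of_nonneg_of_nonpos hru0.le (by linarith)
      have e1 : 2 * k * r - (2 * Δ - (k - r) * (k - r + 1)) = (k ^ 2 + k - 2 * Δ) + (r ^ 2 - r) := by ring
      have e2 : (r - u) * (r - u - 1) = (r ^ 2 - r) - 2 * (u * r) + u * (u + 1) := by ring
      have e3 : 2 * k * (1 - δ) * r = 2 * (u * r) := by rw [hu]; ring
      rw [e1, e3]
      rw [e2] at hquad
      linarith
    have hii : θ₁ / 2 * (2 * k * r - y) ≤ 16 * (1 - δ) / (7 * k) := by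
      have e : θ₁ / 2 * (2 * k * r - y) = (θ₁ * r / 2) * ((2 * k * r - y) / r) := by field_simp
      rw [e]
      have hθr : θ₁ * r / 2 ≤ 8 / (7 * k ^ 2) := by
        have h' : θ₁ * (7 * k ^ 2 * r) ≤ 16 := (le_div_iff₀ (by positivity)).1 hθ1
        rw [div_le_div_iff₀ (by norm_num) (by positivity)]
        have e : θ₁ * r * (7 * k ^ 2) = θ₁ * (7 * k ^ 2 * r) := by ring
        rw [e]; linarith
      calc (θ₁ * r / 2) * ((2 * k * r - y) / r) ≤ 8 / (7 * k ^ 2) * (2 * k * (1 - δ)) :=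
            mul_le_mul hθr hratio (div_nonneg h2kry hr0.le) (by positivity)
        _ = 16 * (1 - δ) / (7 * k) := by field_simp; ring
    -- (iv)+(v): the algebra down to `F`
    rw [hΔ', div_le_iff₀ (by positivity)]
    have hG4 := mul_le_mul_of_nonneg_left hGhi (by positivity : (0:ℝ) ≤ 4 * k ^ 2)
    -- target: `Δ − 2k + 4k²G + (θ₁/2)(2kr−y) ≤ F k δ · k²`
    have hF : (δ - 2 / k + 4 * ((1 - δ) / ((2 - δ ^ 2) * k) + δ / ((2 - δ ^ 2) ^ 2 * k ^ 2)) + 16 * (1 - δ) / (7 * k ^ 3))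
        ≤ F k δ := by
      unfold F A β c
      -- Ford's two inequalities: (a) `4/(2−δ²) ≤ 32(2−δ)/21` i.e. `84 ≤ 32(2−δ)(2−δ²)`; (b) `(1−δ)(2−δ²) ≤ 2−δ`
      have ha' : 84 ≤ 32 * (2 - δ) * (2 - δ ^ 2) := by nlinarith
      have hb' : (1 - δ) * (2 - δ ^ 2) ≤ 2 - δ := by nlinarith
      rw [← sub_nonneg]
      have e : δ * (1 - (2 - δ) / (2 - δ ^ 2) * (2 / k - 32 / (21 * k ^ 2) - 16 / (7 * k ^ 3) / δ)) -
          (δ - 2 / k + 4 * ((1 - δ) / ((2 - δ ^ 2) * k) + δ / ((2 - δ ^ 2) ^ 2 * k ^ 2)) + 16 * (1 - δ) / (7 * k ^ 3)) =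
          δ * (32 * (2 - δ) * (2 - δ ^ 2) - 84) / (21 * (2 - δ ^ 2) ^ 2 * k ^ 2) +
            16 * ((2 - δ) - (1 - δ) * (2 - δ ^ 2)) / (7 * (2 - δ ^ 2) * k ^ 3) := by
        field_simp
        ring
      rw [e]
      have t1 : 0 ≤ δ * (32 * (2 - δ) * (2 - δ ^ 2) - 84) / (21 * (2 - δ ^ 2) ^ 2 * k ^ 2) :=
        div_nonneg (mul_nonneg hδ0.le (by linarith)) (by positivity)
      have t2 : 0 ≤ 16 * ((2 - δ) - (1 - δ) * (2 - δ ^ 2)) / (7 * (2 - δ ^ 2) * k ^ 3) :=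
        div_nonneg (mul_nonneg (by norm_num) (by linarith)) (by positivity)
      linarith
    have hFk := mul_le_mul_of_nonneg_right hF (by positivity : (0:ℝ) ≤ k ^ 2)
    have e2 : (δ - 2 / k + 4 * ((1 - δ) / ((2 - δ ^ 2) * k) + δ / ((2 - δ ^ 2) ^ 2 * k ^ 2)) + 16 * (1 - δ) / (7 * k ^ 3)) * k ^ 2
        = δ * k ^ 2 - 2 * k + 4 * k ^ 2 * ((1 - δ) / ((2 - δ ^ 2) * k) + δ / ((2 - δ ^ 2) ^ 2 * k ^ 2)) + 16 * (1 - δ) / (7 * k) := by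
      field_simp
    rw [e2] at hFk
    rw [hΔδ] at *
    linarith
  · -- lower bound `Δ' ≥ Δ(1 − 2/k)`
    rw [hΔ']
    have hG4 := mul_le_mul_of_nonneg_left hGlo (by positivity : (0:ℝ) ≤ 4 * k ^ 2)
    have e : 4 * k ^ 2 * ((1 - δ) / (2 * k)) = 2 * k * (1 - δ) := by field_simp; ring
    rw [e] at hG4
    have hθ : 0 ≤ θ₁ / 2 * (2 * k * r - y) := by positivity
    have e2 : Δ * (1 - 2 / k) = Δ - 2 * k * δ := by rw [hΔδ]; field_simp
    rw [e2]
    linarith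
  · -- `Δ' ≤ Δ`
    have h1 : (ps + θ₁) / 2 * (2 * k * r - y) ≤ (1 / r) / 2 * (2 * k * r - y) :=
      mul_le_mul_of_nonneg_right (by linarith) h2kry
    have e : (1 / r) / 2 * (2 * k * r - y) = k - y / (2 * r) := by field_simp
    have hy2r : 0 ≤ y / (2 * r) := by positivity
    linarith

include hk hΔk hΔ hr1 hr2 in
/-- `y ≥ 2k − 2` (from `Δ > k`; this is what makes the maximal `j` of (3.8) at least `√(2k−2)`).
[cite: Ford2002, proof of Lemma 3.6 ("(3.13) implies y ≥ 2k − 2")] -/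
theorem y_ge : 2 * k - 2 ≤ yv k r Δ := by
  have hk0 : 0 < k := by linarith
  obtain ⟨hδ1, hδ2, hr3, hr4, hyA, hyB, hy0, hy2⟩ := basic_ranges hk hΔk hΔ hr1 hr2
  have hu1 : 1 < Δ / k := by rw [lt_div_iff₀ hk0]; linarith
  have hu2 : Δ / k ≤ (k - 1) / 2 := by rw [div_le_iff₀ hk0]; nlinarith
  -- `u(2k − u − 1) ≥ 2k − 2` for `1 ≤ u ≤ (k−1)/2`
  nlinarith [mul_nonneg (sub_nonneg.2 hu1.le) (by linarith : (0:ℝ) ≤ 2 * k - Δ / k - 2)]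

/-- **The size of the maximal `j`**: if `j² ≥ 2k − 2` and `k ≥ 1000` then `2^{1−j} ≤ 0.32/k⁴`
(`j ≥ 45`; `(j²+2)⁴ ≤ 5.12 · 2^{j−1}` by induction). [cite: Ford2002, proof of Lemma 3.6 ("for k ≥ 1000, 2^{1−j}/r ≤ 0.071/(k⁴r)")] -/
theorem half_pow_le {k : ℝ} {j : ℕ} (hk : 1000 ≤ k) (hj : 2 * k - 2 ≤ (j : ℝ) ^ 2) :
    (1 / 2 : ℝ) ^ (j - 1) ≤ 0.32 / k ^ 4 := by
  have hk0 : 0 < k := by linarith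
  have hj45 : 45 ≤ j := by
    by_contra h
    push Not at h
    have : (j : ℝ) ≤ 44 := by exact_mod_cast Nat.lt_succ_iff.1 h
    nlinarith
  -- `(j² + 2)⁴ ≤ 5.12 · 2^{j−1}` for `j ≥ 45`
  have hind : ∀ n : ℕ, 45 ≤ n → ((n : ℝ) ^ 2 + 2) ^ 4 ≤ 5.12 * 2 ^ (n - 1) := by
    refine Nat.le_induction (by norm_num) fun n hn ih ↦ ?_
    have hn' : (45 : ℝ) ≤ n := by exact_mod_cast hn
    have h1 : ((n : ℝ) + 1) ^ 2 + 2 ≤ 1.189 * ((n : ℝ) ^ 2 + 2) := by nlinarith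
    have h2 : (((n : ℝ) + 1) ^ 2 + 2) ^ 4 ≤ (1.189 * ((n : ℝ) ^ 2 + 2)) ^ 4 :=
      pow_le_pow_left₀ (by positivity) h1 4
    push_cast
    have e : (2 : ℝ) ^ n = 2 ^ (n - 1) * 2 := by
      rw [← pow_succ]; congr 1; omega
    rw [e]
    nlinarith [h2, ih, pow_nonneg (show (0:ℝ) ≤ (n : ℝ) ^ 2 + 2 by positivity) 4]
  have hP := hind j hj45
  -- `k⁴ ≤ ((j²+2)/2)⁴`
  have hkj : k ≤ ((j : ℝ) ^ 2 + 2) / 2 := by linarith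
  have hk4 : k ^ 4 ≤ (((j : ℝ) ^ 2 + 2) / 2) ^ 4 := pow_le_pow_left₀ hk0.le hkj 4
  rw [div_eq_mul_inv, le_div_iff₀ (by positivity)]
  have h2pos : (0 : ℝ) < 2 ^ (j - 1) := by positivity
  calc (1 / 2 : ℝ) ^ (j - 1) * k ^ 4 ≤ (1 / 2) ^ (j - 1) * (((j : ℝ) ^ 2 + 2) / 2) ^ 4 :=
        mul_le_mul_of_nonneg_left hk4 (by positivity)
    _ = ((j : ℝ) ^ 2 + 2) ^ 4 / 16 * (1 / 2) ^ (j - 1) := by ring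
    _ ≤ 5.12 * 2 ^ (j - 1) / 16 * (1 / 2) ^ (j - 1) := by gcongr
    _ = 0.32 := by rw [one_div_pow]; field_simp; norm_num

include hk hΔk hΔ hr1 hr2 in
/-- **`θ₁ ≤ 16/(7k²r)`** from `θ₁ ≤ 2^{1−j}(1/r − φ*) + 2φ*/(kr)` (`theta_one_le`), (3.15) and `2^{1−j} ≤ 0.32/k⁴`.
[cite: Ford2002, proof of Lemma 3.6 ("θ₁ ≤ 0.071/(k⁴r) + 16/(7k²r) − 0.32/(k⁴r) ≤ 16/(7k²r)")] -/
theorem theta_one_le_final {j : ℕ} (hθ : θ₁ ≤ (1 / 2 : ℝ) ^ (j - 1) * (1 / r - phiStar k r (yv k r Δ)) +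
      2 * phiStar k r (yv k r Δ) / (k * r)) (hj : (1 / 2 : ℝ) ^ (j - 1) ≤ 0.32 / k ^ 4) :
    θ₁ ≤ 16 / (7 * k ^ 2 * r) := by
  have hk0 : 0 < k := by linarith
  obtain ⟨hδ1, hδ2, hr3, hr4, hyA, hyB, hy0, hy2⟩ := basic_ranges hk hΔk hΔ hr1 hr2
  have hr0 : 0 < r := by linarith
  have hps := phiStar_le hk hΔk hΔ hr1 hr2
  have hps0 : 0 ≤ phiStar k r (yv k r Δ) := (phiStar_pos hk0 hr0 hy0).le
  have h1 : (1 / 2 : ℝ) ^ (j - 1) * (1 / r - phiStar k r (yv k r Δ)) ≤ 0.32 / k ^ 4 * (1 / r) := by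
    refine mul_le_mul hj (by linarith) (by linarith [phiStar_le_inv hk0 hr0 hy0 (k := k) (r := r) (y := yv k r Δ)]) (by positivity)
  have h2 : 2 * phiStar k r (yv k r Δ) / (k * r) ≤ 2 * (8 / (7 * k) - 0.16 / k ^ 3) / (k * r) :=
    div_le_div_of_nonneg_right (by linarith) (by positivity)
  refine hθ.trans ((add_le_add h1 h2).trans (le_of_eq ?_))
  field_simp
  ring

end Step

end FordL36
end Literature.NumberTheory.LFunctions
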